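import Summits.CriticalPhenomena.SAWScalingLimit.Theorems.SAWDefectDecoherenceBoundaryClosureRPhaseGeometry
import Summits.CriticalPhenomena.SAWScalingLimit.Theorems.SAWDefectDecoherenceBoundaryClosureRPolygonLocalCornerFace
import Summits.CriticalPhenomena.SAWScalingLimit.Theorems.SAWDefectDecoherenceBoundaryClosureRZigzagDiscretisationCharts
import Mathlib.Analysis.Convex.PathConnected
import HarnessLib

/-!
# Crux `BoundaryClosureR` (stmt-CriticalPhenomena-14004), line `polygon-parity-squeeze`,
# stub `boundaryPhaseBookkeeping` (piece D): plane geometry of genuine zigzag corner balls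

For an open set `U` which, inside `B(c, s)`, is the convex corner `H_k ∩ H_{k'}` or the reflex
corner `H_k ∪ H_{k'}` of two zigzag half-planes through `c` with `n_{k'} ≠ ± n_k`:

* (landed `PolygonLocal.level_ne_zero_of_ray`) a non-zero vector on the side line of `H_k` is
  off the side line of `H_{k'}` (the two normals are real-linearly independent);
* `level_eq_zero_or_of_mem_frontier` — frontier points of `U` in the ball lie on one of the two
  side lines;
* `flat_of_mem_ray` — a frontier point `q ≠ c` on the side line of `H_k` is a FLAT point of form
  `k`: `U ∩ B(q, t) = halfPlane k q ∩ B(q, t)` for some `B(q, t) ⊆ B(c, s)`;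
* `exists_mem_ray` — such points exist in every `B(c, t)`, `0 < t ≤ s`;
* `isPreconnected_corner` — the corner ball is preconnected (convex, resp. star-shaped about a
  test point of `H_k ∩ H_{k'}`);
* `inter_opp_eq_empty`, `union_opp_eq` — the degenerate presentations with opposite normals are
  the empty set and the slit ball.

All statements are folklore plane geometry; no proposition is defined.
-/

noncomputable section

open scoped ComplexConjugate Topology
open Set Metric Filter

namespace Summit.CriticalPhenomena.SAWScalingLimit.Theorems.PolygonParitySqueeze

namespace PhaseGeometry


/-! ### 1. Frontier points of a corner ball -/

/-- Closure points of `halfPlane k c` have non-negative level. [folklore] -/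
theorem level_nonneg_of_mem_closure {k : Fin 6} {c q : ℂ} (h : q ∈ closure (halfPlane k c)) :
    0 ≤ ((q - c) * conj (innerNormal k)).re :=
  closure_lt_subset_le continuous_const (ZigzagDiscretisation.continuous_level k c) h

/-- **Frontier points of a genuine corner ball lie on one of the two side lines.** [folklore] -/
theorem level_eq_zero_or_of_mem_frontier {U : Set ℂ} (hU : IsOpen U) {k k' : Fin 6} {c : ℂ}
    {s : ℝ} (hset : U ∩ ball c s = halfPlane k c ∩ halfPlane k' c ∩ ball c s ∨
      U ∩ ball c s = (halfPlane k c ∪ halfPlane k' c) ∩ ball c s)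
    {q : ℂ} (hq : q ∈ frontier U) (hqs : q ∈ ball c s) :
    ((q - c) * conj (innerNormal k)).re = 0 ∨ ((q - c) * conj (innerNormal k')).re = 0 := by
  rw [frontier, hU.interior_eq] at hq
  obtain ⟨hqc, hqU⟩ := hq
  have hcl : q ∈ closure (U ∩ ball c s) := by
    rw [inter_comm]
    exact isOpen_ball.inter_closure ⟨hqs, hqc⟩
  rcases hset with hset | hset
  · rw [hset] at hcl
    have h1 : 0 ≤ ((q - c) * conj (innerNormal k)).re := level_nonneg_of_mem_closure
      (closure_mono (inter_subset_left.trans inter_subset_left) hcl)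
    have h2 : 0 ≤ ((q - c) * conj (innerNormal k')).re := level_nonneg_of_mem_closure
      (closure_mono (inter_subset_left.trans inter_subset_right) hcl)
    have h3 : ¬ (0 < ((q - c) * conj (innerNormal k)).re ∧ 0 < ((q - c) * conj (innerNormal k')).re) := by
      rintro ⟨h, h'⟩
      have : q ∈ U ∩ ball c s := by rw [hset]; exact ⟨⟨h, h'⟩, hqs⟩
      exact hqU this.1
    rcases not_and_or.1 h3 with h | h
    · exact Or.inl (le_antisymm (not_lt.1 h) h1)
    · exact Or.inr (le_antisymm (not_lt.1 h) h2)
  · rw [hset] at hcl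
    have hcl' : q ∈ closure (halfPlane k c) ∪ closure (halfPlane k' c) := by
      rw [← closure_union]
      exact closure_mono inter_subset_left hcl
    have h3 : ¬ 0 < ((q - c) * conj (innerNormal k)).re ∧ ¬ 0 < ((q - c) * conj (innerNormal k')).re := by
      refine not_or.1 fun h => ?_
      have : q ∈ U ∩ ball c s := by rw [hset]; exact ⟨h, hqs⟩
      exact hqU this.1
    rcases hcl' with h | h
    · exact Or.inl (le_antisymm (not_lt.1 h3.1) (level_nonneg_of_mem_closure h))
    · exact Or.inr (le_antisymm (not_lt.1 h3.2) (level_nonneg_of_mem_closure h))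

/-- Levels add along differences: `ℓ(w - c) = ℓ(w - q) + ℓ(q - c)`. [folklore] -/
theorem level_split (k : Fin 6) (w q c : ℂ) : ((w - c) * conj (innerNormal k)).re =
    ((w - q) * conj (innerNormal k)).re + ((q - c) * conj (innerNormal k)).re := by
  rw [← Complex.add_re, ← add_mul, sub_add_sub_cancel]

/-- **A frontier point `q ≠ c` of a genuine corner ball on the side line of `H_k` is a flat point
of form `k`.** [folklore] -/
theorem flat_of_mem_ray {U : Set ℂ} (hU : IsOpen U) {k k' : Fin 6} {c : ℂ} {s : ℝ}
    (hk : innerNormal k' ≠ innerNormal k) (hk' : innerNormal k' ≠ -innerNormal k)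
    (hset : U ∩ ball c s = halfPlane k c ∩ halfPlane k' c ∩ ball c s ∨
      U ∩ ball c s = (halfPlane k c ∪ halfPlane k' c) ∩ ball c s)
    {q : ℂ} (hq : q ∈ frontier U) (hqs : q ∈ ball c s) (hqc : q ≠ c)
    (hlev : ((q - c) * conj (innerNormal k)).re = 0) :
    ∃ t : ℝ, 0 < t ∧ ball q t ⊆ ball c s ∧ U ∩ ball q t = halfPlane k q ∩ ball q t := by
  have hne : ((q - c) * conj (innerNormal k')).re ≠ 0 :=
    PolygonLocal.level_ne_zero_of_ray hk hk' (sub_ne_zero.2 hqc) hlev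
  have hqfr := hq
  rw [frontier, hU.interior_eq] at hq
  obtain ⟨hqcl, hqU⟩ := hq
  have hgap : 0 < s - dist q c := by rw [sub_pos]; exact mem_ball.1 hqs
  set ℓ' : ℝ := ((q - c) * conj (innerNormal k')).re with hℓ'
  set t : ℝ := min (s - dist q c) |ℓ'| with ht
  have ht0 : 0 < t := lt_min hgap (abs_pos.2 hne)
  have hsub : ball q t ⊆ ball c s := by
    intro w hw
    rw [mem_ball] at hw ⊢
    have := min_le_left (s - dist q c) |ℓ'|
    linarith [dist_triangle w q c]
  refine ⟨t, ht0, hsub, ?_⟩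
  rw [halfPlane_eq_of_level_eq_zero hlev]
  have hUt : U ∩ ball q t = (U ∩ ball c s) ∩ ball q t := by
    rw [inter_assoc, inter_eq_right.2 hsub]
  rcases hset with hset | hset
  · -- convex corner: `ℓ' > 0` and the small ball lies inside `H_{k'}`
    have hpos : 0 < ℓ' := lt_of_le_of_ne (by
      have hcl : q ∈ closure (U ∩ ball c s) := by
        rw [inter_comm]; exact isOpen_ball.inter_closure ⟨hqs, hqcl⟩
      rw [hset] at hcl
      exact level_nonneg_of_mem_closure
        (closure_mono (inter_subset_left.trans inter_subset_right) hcl)) (Ne.symm hne)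
    have hball : ball q t ⊆ halfPlane k' c :=
      ball_subset_halfPlane_of_level k' c q t (by rw [ht, abs_of_pos hpos]; exact min_le_right _ _)
    rw [hUt, hset]
    ext w
    simp only [mem_inter_iff]
    constructor
    · rintro ⟨⟨⟨h1, -⟩, -⟩, h3⟩; exact ⟨h1, h3⟩
    · rintro ⟨h1, h3⟩; exact ⟨⟨⟨h1, hball h3⟩, hsub h3⟩, h3⟩
  · -- reflex corner: `ℓ' < 0` and the small ball misses `H_{k'}`
    have hneg : ℓ' < 0 := lt_of_le_of_ne (by
      by_contra h
      push Not at h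
      have : q ∈ U ∩ ball c s := by rw [hset]; exact ⟨Or.inr h, hqs⟩
      exact hqU this.1) hne
    have hball : ∀ w ∈ ball q t, w ∉ halfPlane k' c := by
      intro w hw hw'
      rw [mem_halfPlane_iff_level, level_split k' w q c] at hw'
      have h1 := abs_level_le_dist k' q w
      have h2 : dist w q < t := mem_ball.1 hw
      have h3 : t ≤ -ℓ' := by rw [ht, ← abs_of_neg hneg]; exact min_le_right _ _
      have h4 := le_abs_self ((w - q) * conj (innerNormal k')).re
      linarith
    rw [hUt, hset]
    ext w
    simp only [mem_inter_iff, mem_union]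
    constructor
    · rintro ⟨⟨h1 | h1, -⟩, h3⟩
      · exact ⟨h1, h3⟩
      · exact absurd h1 (hball w h3)
    · rintro ⟨h1, h3⟩; exact ⟨⟨Or.inl h1, hsub h3⟩, h3⟩

/-- **Side-line points exist near the apex of a genuine corner ball**: for `0 < t ≤ s` there is a
frontier point `q ≠ c` in `B(c, t)` on the side line of `H_k`. [folklore] -/
theorem exists_mem_ray {U : Set ℂ} (hU : IsOpen U) {k k' : Fin 6} {c : ℂ} {s : ℝ}
    (hk : innerNormal k' ≠ innerNormal k) (hk' : innerNormal k' ≠ -innerNormal k)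
    (hset : U ∩ ball c s = halfPlane k c ∩ halfPlane k' c ∩ ball c s ∨
      U ∩ ball c s = (halfPlane k c ∪ halfPlane k' c) ∩ ball c s)
    {t : ℝ} (ht : 0 < t) (hts : t ≤ s) :
    ∃ q ∈ frontier U ∩ ball c t, q ≠ c ∧ ((q - c) * conj (innerNormal k)).re = 0 := by
  -- the tangent direction `d = i n_k` of the side line of `H_k`, and its level w.r.t. `n_{k'}`
  set d : ℂ := Complex.I * innerNormal k with hd
  have hd0 : d ≠ 0 := mul_ne_zero Complex.I_ne_zero (by
    intro h; have := norm_innerNormal k; rw [h, norm_zero] at this; exact zero_ne_one this)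
  have hdk : (d * conj (innerNormal k)).re = 0 := by
    rw [hd, mul_assoc, Complex.mul_re, Complex.I_re, Complex.I_im, zero_mul, one_mul, zero_sub,
      neg_eq_zero, Complex.mul_conj, ← Complex.ofReal_im (Complex.normSq (innerNormal k))]
  have hdk' : (d * conj (innerNormal k')).re ≠ 0 := PolygonLocal.level_ne_zero_of_ray hk hk' hd0 hdk
  have hnd : ‖d‖ = 1 := by rw [hd, norm_mul, Complex.norm_I, one_mul, norm_innerNormal]
  -- choose the sign: towards `H_{k'}` for a convex corner, away from it for a reflex one
  obtain ⟨e, he1, hek, hek'⟩ : ∃ e : ℂ, ‖e‖ = 1 ∧ (e * conj (innerNormal k)).re = 0 ∧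
      ((U ∩ ball c s = halfPlane k c ∩ halfPlane k' c ∩ ball c s ∧ 0 < (e * conj (innerNormal k')).re) ∨
       (U ∩ ball c s = (halfPlane k c ∪ halfPlane k' c) ∩ ball c s ∧ (e * conj (innerNormal k')).re < 0)) := by
    have hneg : ∀ n : ℂ, (-d * conj n).re = -(d * conj n).re := fun n => by
      rw [neg_mul, Complex.neg_re]
    rcases hset with hset | hset
    · rcases lt_or_gt_of_ne hdk' with h | h
      · exact ⟨-d, by rw [norm_neg, hnd], by rw [hneg, hdk, neg_zero], Or.inl ⟨hset, by rw [hneg]; linarith⟩⟩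
      · exact ⟨d, hnd, hdk, Or.inl ⟨hset, h⟩⟩
    · rcases lt_or_gt_of_ne hdk' with h | h
      · exact ⟨d, hnd, hdk, Or.inr ⟨hset, h⟩⟩
      · exact ⟨-d, by rw [norm_neg, hnd], by rw [hneg, hdk, neg_zero], Or.inr ⟨hset, by rw [hneg]; linarith⟩⟩
  set q : ℂ := c + ((t / 2 : ℝ) : ℂ) * e with hq
  have hqc : q - c = ((t / 2 : ℝ) : ℂ) * e := by rw [hq, add_sub_cancel_left]
  have hqne : q ≠ c := by
    intro h
    have : ((t / 2 : ℝ) : ℂ) * e = 0 := by rw [← hqc, h, sub_self]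
    rcases mul_eq_zero.1 this with h1 | h1
    · exact absurd (Complex.ofReal_eq_zero.1 h1) (by positivity)
    · rw [h1, norm_zero] at he1; exact zero_ne_one he1
  have hqt : q ∈ ball c t := by
    rw [mem_ball, dist_eq_norm, hqc, norm_mul, he1, mul_one, Complex.norm_real,
      Real.norm_of_nonneg (by positivity)]
    linarith
  have hqs : q ∈ ball c s := ball_subset_ball hts hqt
  have hlevk : ((q - c) * conj (innerNormal k)).re = 0 := by
    rw [hqc, mul_assoc, Complex.re_ofReal_mul, hek, mul_zero]
  have hlevk' : ((q - c) * conj (innerNormal k')).re = t / 2 * (e * conj (innerNormal k')).re := by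
    rw [hqc, mul_assoc, Complex.re_ofReal_mul]
  refine ⟨q, ⟨?_, hqt⟩, hqne, hlevk⟩
  rw [frontier, hU.interior_eq]
  refine ⟨?_, fun hqU => ?_⟩
  · -- approach `q` along the normal `n_k`
    have hray := PickHalfPlane.Identification.tendsto_ray q (innerNormal k)
    refine mem_closure_of_tendsto hray ?_
    have hopen : IsOpen {w : ℂ | 0 < ((w - c) * conj (innerNormal k')).re} :=
      isOpen_lt continuous_const (ZigzagDiscretisation.continuous_level k' c)
    have hev : ∀ᶠ r : ℝ in 𝓝[>] 0, q + (r : ℂ) * innerNormal k ∈ ball c s ∧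
        0 < ((q + (r : ℂ) * innerNormal k - c) * conj (innerNormal k)).re := by
      filter_upwards [hray (isOpen_ball.mem_nhds hqs), self_mem_nhdsWithin] with r hr hr0
      refine ⟨hr, ?_⟩
      have hr0' : (0 : ℝ) < r := hr0
      have : (q + (r : ℂ) * innerNormal k - c) * conj (innerNormal k) =
          (q - c) * conj (innerNormal k) + (r : ℂ) * (innerNormal k * conj (innerNormal k)) := by ring
      rw [this, Complex.add_re, hlevk, zero_add, Complex.re_ofReal_mul, re_innerNormal_mul_conj, mul_one]
      exact hr0'
    rcases hek' with ⟨hset, hpos⟩ | ⟨hset, hneg⟩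
    · have hq' : q ∈ {w : ℂ | 0 < ((w - c) * conj (innerNormal k')).re} := by
        show 0 < ((q - c) * conj (innerNormal k')).re
        rw [hlevk']; positivity
      filter_upwards [hev, hray (hopen.mem_nhds hq')] with r hr hr'
      have hmem : q + (r : ℂ) * innerNormal k ∈ U ∩ ball c s := by
        rw [hset]; exact ⟨⟨hr.2, hr'⟩, hr.1⟩
      exact hmem.1
    · filter_upwards [hev] with r hr
      have hmem : q + (r : ℂ) * innerNormal k ∈ U ∩ ball c s := by
        rw [hset]; exact ⟨Or.inl hr.2, hr.1⟩
      exact hmem.1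
  · have hmem : q ∈ U ∩ ball c s := ⟨hqU, hqs⟩
    rcases hek' with ⟨hset, hpos⟩ | ⟨hset, hneg⟩
    · rw [hset] at hmem
      have h := (mem_halfPlane_iff_level k c q).1 hmem.1.1
      rw [hlevk] at h
      exact lt_irrefl _ h
    · rw [hset] at hmem
      rcases hmem.1 with h | h
      · rw [mem_halfPlane_iff_level, hlevk] at h; exact lt_irrefl _ h
      · rw [mem_halfPlane_iff_level, hlevk'] at h
        have : t / 2 * (e * conj (innerNormal k')).re < 0 := mul_neg_of_pos_of_neg (by positivity) hneg
        linarith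

/-! ### 2. Preconnectedness; degenerate presentations -/

/-- Zigzag half-planes are convex. [folklore] -/
theorem convex_halfPlane (k : Fin 6) (c : ℂ) : Convex ℝ (halfPlane k c) := by
  have hlin : IsLinearMap ℝ fun w : ℂ => (w * conj (innerNormal k)).re :=
    { map_add := fun x y => by rw [add_mul, Complex.add_re]
      map_smul := fun r x => by
        simp only [Complex.real_smul, mul_assoc, Complex.re_ofReal_mul, smul_eq_mul] }
  have heq : halfPlane k c = {w : ℂ | (c * conj (innerNormal k)).re < (w * conj (innerNormal k)).re} := by
    ext w
    rw [mem_halfPlane_iff_level, mem_setOf_eq, sub_mul, Complex.sub_re, sub_pos]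
  rw [heq]
  exact convex_halfSpace_gt hlin _

/-- **A corner ball with non-opposite normals is preconnected** (convex, resp. star-shaped about
a test point of `H_k ∩ H_{k'} ∩ B`). [folklore] -/
theorem isPreconnected_corner {k k' : Fin 6} (hk' : innerNormal k' ≠ -innerNormal k) (c : ℂ)
    (s : ℝ) {V : Set ℂ} (hset : V = halfPlane k c ∩ halfPlane k' c ∩ ball c s ∨
      V = (halfPlane k c ∪ halfPlane k' c) ∩ ball c s) : IsPreconnected V := by
  rcases hset with hset | hset
  · rw [hset]
    exact (((convex_halfPlane k c).inter (convex_halfPlane k' c)).inter (convex_ball c s)).isPreconnected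
  · rcases le_or_gt s 0 with hs | hs
    · rw [hset, Metric.ball_eq_empty.2 hs, inter_empty]
      exact isPreconnected_empty
    · obtain ⟨j, hj⟩ := exists_testPoint_mem_inter hk' c hs
      have hV : V = (halfPlane k c ∩ ball c s) ∪ (halfPlane k' c ∩ ball c s) := by
        rw [hset, union_inter_distrib_right]
      have hstar : StarConvex ℝ (c + ((s / 2 : ℝ) : ℂ) * innerNormal j) V := by
        rw [hV]
        exact (((convex_halfPlane k c).inter (convex_ball c s)).starConvex ⟨hj.1.1, hj.2⟩).union
          (((convex_halfPlane k' c).inter (convex_ball c s)).starConvex ⟨hj.1.2, hj.2⟩)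
      have hmem : c + ((s / 2 : ℝ) : ℂ) * innerNormal j ∈ V := by
        rw [hV]; exact Or.inl ⟨hj.1.1, hj.2⟩
      exact (hstar.isPathConnected hmem).isConnected.isPreconnected

/-- **The degenerate convex presentation with opposite normals is empty.** [folklore] -/
theorem inter_opp_eq_empty {k k' : Fin 6} (h : innerNormal k' = -innerNormal k) (c : ℂ) :
    halfPlane k c ∩ halfPlane k' c = ∅ := by
  rw [halfPlane_of_innerNormal_eq_neg h]
  ext w
  simp only [mem_inter_iff, mem_halfPlane_iff_level, mem_setOf_eq, mem_empty_iff_false, iff_false,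
    not_and, not_lt]
  exact fun h => h.le

/-- **The degenerate reflex presentation with opposite normals is the slit plane through `c`.**
[folklore] -/
theorem union_opp_eq {k k' : Fin 6} (h : innerNormal k' = -innerNormal k) (c : ℂ) :
    halfPlane k c ∪ halfPlane k' c = {w : ℂ | ((w - c) * conj (innerNormal k)).re ≠ 0} := by
  rw [halfPlane_of_innerNormal_eq_neg h]
  ext w
  simp only [mem_union, mem_halfPlane_iff_level, mem_setOf_eq]
  constructor
  · rintro (h | h)
    · exact h.ne'
    · exact h.ne
  · intro h
    rcases lt_or_gt_of_ne h with h | h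
    · exact Or.inr h
    · exact Or.inl h

/-! ### Registered form -/

/-- **Registered helper `phaseBookkeeping_flatOfMemRay`** (∀-closed form of `flat_of_mem_ray`;
sub-goal of stub `boundaryPhaseBookkeeping`, crux stmt-CriticalPhenomena-14004, line
`polygon-parity-squeeze`): side points of a genuine corner ball are flat points. [folklore] -/
theorem phaseBookkeeping_flatOfMemRay : ∀ (U : Set ℂ), IsOpen U → ∀ (k k' : Fin 6) (c : ℂ) (s : ℝ), innerNormal k' ≠ innerNormal k → innerNormal k' ≠ -innerNormal k → (U ∩ Metric.ball c s = halfPlane k c ∩ halfPlane k' c ∩ Metric.ball c s ∨ U ∩ Metric.ball c s = (halfPlane k c ∪ halfPlane k' c) ∩ Metric.ball c s) → ∀ q ∈ frontier U ∩ Metric.ball c s, q ≠ c → ((q - c) * (starRingEnd ℂ) (innerNormal k)).re = 0 → ∃ t : ℝ, 0 < t ∧ Metric.ball q t ⊆ Metric.ball c s ∧ U ∩ Metric.ball q t = halfPlane k q ∩ Metric.ball q t :=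
  fun _ hU _ _ _ _ hk hk' hset _ hq hqc hlev => flat_of_mem_ray hU hk hk' hset hq.1 hq.2 hqc hlev

end PhaseGeometry

end Summit.CriticalPhenomena.SAWScalingLimit.Theorems.PolygonParitySqueeze

end
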